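import Summits.QuantumFields.YangMills.Theorems.BalabanUVNodesN19RateEdgeHolderAtRecord13CoPH
import Summits.QuantumFields.YangMills.Theorems.BalabanUVNodesSpineReadingOfRecord13CoPH
import Literature.MathematicalPhysics.QuantumFieldTheory.Balaban1983to89.Node00.Record12MeasurabilityAbsolute

/-!
# BalabanUVNodes ∕ N19 — THE R-β RATE EDGE AT THE SPINE READING OF RECORD `crOfRecord₁₃At K₀ jcut sh` (Stage-13 `CoPH`): N19′'s core
# `NE7.Core` AND U4′'s `Summable δ` AT THE READING's OWN CANONICAL RATE `δ`, BY NAME, MODULO THE DISPLAYED LINK READING AND K4's β-RATES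

Cell `pub-ymgap`, HUMAN RULING D-0062 (Track A) + D-0149 (work-bound push, director-ym №197), R134 ACCELERATION seat `pub-ymgap-dag-n19-d`
(N19 NE7, strategy s2 = by-name knit at the record), generation g23; bus INTENT-H (pub-ymgap INBOX l.24844).  Route
`Summits/QuantumFields/YangMills/Theses/BalabanUVNodes.lean` rev 25, cluster item K3⁷ «SpineGivenEndpointR13SepCoPH» (stmt-QuantumFields-20544); filed
`--kind proof --supports` that item `--as helper` (it proves no registered stub).  COUNT-NEUTRAL.  THEOREMS ONLY; 0 `def`; 0 `sorry`; `N`-generic; NO Theses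
import.  Imports the sibling F `…N19RateEdgeHolderAtRecord13CoPH` (p583345: `h19Holder_datumOfRecord₁₃CoPH_of_linkReading` for ANY θ-keyed spine reading `cr`,
`hybridNE7Under_guarded_…` via dag-n27-c XXIVc), dag-n20-d's SPINE READING OF RECORD `…SpineReadingOfRecord13CoPH` (`crOfRecord₁₃At K₀ jcut sh :
SpineReading₁₃CoPH N` — node U5d's σ-packed two-run keys, the class set `classSet₁₃`, the fibre-sum class weights `weightA₁₃ ∕ weightB₁₃` of F3's
`classWeightOfDatum₉` at the tuple's own datum, the persistence class `badClass₁₃ … jcut`, the DISPLAYED shell split `sh`, CANONICAL `W ∕ Wsh ∕ δ` from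
`…SpineCanonicalWeights`; its dictionary §4, extraction theorem §5 and transfers §6) and node00-def-K0c's `Node00/Record12MeasurabilityAbsolute` (the
hypothesis-free `localBgMeasurable`) — all CITED BY NAME, none edited.  This is the director's R134 row «knit `Spine.NE7.Core` … at the spine carriers with
`summable_deltaOfRecord` displayed honestly» AT THE STAGE-13 `CoPH` RECORD AND READING OF RECORD, in the plan's R-β currency.

WHAT THIS FILE PROVES (`N`-generic; `S := crOfRecord₁₃At K₀ jcut sh F θ hP g₀ os`, `R := rateCarriersOfRecord₁₃CoPH 𝔯 F θ hP g₀ os k`,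
`D := datumOfRecord₁₃CoPH F N θ hP`).
* §1 ★★ `core_crOfRecord₁₃At_of_linkReading` — for any offset `K₀`, persistence policy `jcut`, shell split `sh`, rate reading of record `𝔯`, guard `G`,
  `β ≤ 1`: IF the link reading `hlink` holds AT THE READING (the «v9» ∃-clause of `N19RateEdgeHolder` VERBATIM under `let S R D` as above; NODE O's
  `LedgerDataSync R.u3.C F′ ι′ S.ι` world) — THEN at every guarded admissible tuple, every `g₀ os k`: `RatesHolderAt D R β →` (non-negative good-class
  cores) `→ NE7.Core S.l₀ S.vol S.T S.Bad (S.A − S.shA) (S.B − S.shB) S.δ ∧ Summable S.δ`.  Proof: F's §1 at `cr := crOfRecord₁₃At K₀ jcut sh` gives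
  `∃ δ, NE7.Core … δ ∧ Summable δ`; dag-n20-d's `core_crOfRecord₁₃At` transfers ANY such witness to the reading's canonical `δ = deltaCan …` (least admissible
  core rate + `2^{−K}`).  READING RULE (ref-B PIN-N19-DELTAOFRECORD of record, applied verbatim): `Summable S.δ` here is a COROLLARY of the edge, not independent
  content; the content sits in `hlink` and the β-rates.
  ★ `core_crOfRecord₁₃At_of_linkReading_of_shellWeightBound` — the sign condition read from ANY shell witness `ShellWeightBound 1 (classSet₁₃ …) (weightA₁₃ …)
  (weightB₁₃ …) (sh …).1 (sh …).2 Wsh` (dag-n20-d `core_nonneg_of_shellWeightBound`); ★ `…_of_shellWeightBound_self` — N21's face AT the reading as leaf D ∕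
  XXIVc display it (`ShellWeightBound S.l₀ S.T S.A S.B S.shA S.shB S.Wsh`).
* §2 ★ `hybridNE7Under_guarded_datumOfRecord₁₃CoPH_crOfRecord₁₃At_of_ratesHolder_linkReading` — XXIVc `keyedGuarded₁₃CoPH_of_keyedFacesRatesHolder` at the reading
  for `rr F θ hP g₀ os := rateCarriersOfRecord₁₃CoPH 𝔯 F θ hP g₀ os (ks F θ hP g₀ os)`: `h19 :=` F's §1; `hx :=` dag-n20-d's THEOREM `keyedExtraction_crOfRecord₁₃At`
  under the DISPLAYED live-selector pin laws `hsel : θ.ppSel = ppSelLiveOfRecord F N θ.ν θ.τ9 (E F θ hP) (wOfRecord₉ F N θ.toStage9Params)`, `hζm`, `hζ0`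
  (`hU :=` K0c's absolute `localBgMeasurable`); `h20` ∕ `h21` from ANY weight witnesses at the reading's keyed carriers (dag-n20-d's `relWeightBound_crOfRecord₁₃At` ∕
  `shellWeightBound_crOfRecord₁₃At`); `hrates` displayed ⇒ `HybridNE7Under D END` at every guarded admissible tuple.  The `N = 2` route-facing face is the sibling
  `…N19RateEdgeHolderK3R13SepCoPHAtSpineReading` (Theses importer).
LOCATED (this seat, pub-ymgap INBOX l.25098, for dag-n20-d): the reading of record as landed (p587226) pins the volume letter `vol := 1`; N19's link reading
READS `S.vol` as the physical volume (the (ii-m) clause `∀ K, (Fintype.card (Site (Pf K) (Pf K).K) : ℝ) = S.vol`, the ledger size bound, the multiplicities,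
(ii-v)'s `gammaVol ≤ S.vol`, (ii-d)'s `Q.card ≤ S.vol`), so AT `vol = 1` the (ii-m) clause asks a one-site top lattice and `hlink` at the reading is NOT
inhabitable by the family's own lattices (`Fintype.card (Site (F.P n) n) = F.side ^ 4`, dag-n19-w3 p586569 §7) — a vacuity located IN THE READING's letter,
not in N19; the theorems below never read the value of `vol` and re-elaborate unchanged under a re-pin `vol := F.side ^ 4` (asked of dag-n20-d).

HONEST FRAMING.  Count-neutral kernel bookkeeping (one application per theorem); `hlink` is a HYPOTHESIS (NODE O's world, K2⁷; 0 instances in the tree); `hr` ∕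
`hrates` (K4's six β-rates), the weight witnesses (N20 ∕ N21), the pin laws (K0⁷'s witness of record satisfies them by `rfl` ∕ K0b–K0c theorems — not claimed
here for any θ) are HYPOTHESES; `K₀ jcut sh 𝔯 G ks E` are PARAMETERS (the shell split `sh` is NODE O's ∕ N21's located object, NOT inhabited; dag-n20-d Q1).  NE7 for
Bałaban's two runs is NOT PRINTED and NOT proved; nothing of Bałaban's is asserted or instantiated (K0⁷ OPEN); N19 NOT discharged; K3⁷ NOT claimed; Track A count
unmoved (typed 28∕28 · discharged 5∕27 · A 5∕28).  One finite four-torus at fixed ε, rung (B)+1 — NOT infinite volume, NOT OS on ℝ⁴, NOT a mass gap, NOT Clay.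
Standard axioms.  Supersedes nothing; edits nothing.  Shape references: [Balaban1988Convergent] Thm 2 (2.43) p.262, (2.18) p.257, (3.10)–(3.11) p.266 (NAMES of
displayed hypotheses ∕ bookkeeping only — nothing asserted).
-/

set_option autoImplicit false

noncomputable section

open Finset MeasureTheory
open scoped BigOperators Matrix Matrix.Norms.L2Operator

namespace Summit.QuantumFields.YangMills.BalabanUVNodes.N19RateEdgeHolderAtSpineReadingOfRecord13CoPH

open Literature.MathematicalPhysics.QuantumFieldTheory.Balaban1983to89
open T4OutputRate T4RecentScale T4GoodClassBudget T4CauchySum T4TowerRateComposition T4TowerRateDischarge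
open T4EtaRateMin (Readings NE3Shape)
open T4RateLiaison (GaugeDominated)
open T4CouplingMatching (EventualLowerH)
open FlowStep (RGEqH)
open TreeLengthTorus (TFaceConnected torusTreeLen)
open B12TreeDecay (kappa₀)
open Summit.QuantumFields.BalabanUV.T4Continuum
open AveragingDeficitDualResidual (dualC1 dualC2)
open AveragingDeficitDerivWallProof (wallConst)
open AveragingDeficitPeriodicCounting (IsPeriodicDir)
open MinimalActionSandwich (IsMinimiser minAct)
open MinimalActionRate (sfClass)
open MinimalActionRefine (RegularSup gradConst)
open NE3EnergyShapes (IsUnitarySite IsPeriodicSite)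
open NE3.LeafIndexSockets (LeafH3sup)
open Summit.QuantumFields.BalabanUV.T4Continuum.Spine
open Summit.QuantumFields.BalabanUV.T4Continuum.NE1p.DressedRoot (DressedTower DressedStabilityStrict)
open Summit.QuantumFields.YangMills.BalabanUVNodes.N19LedgerLinkSync (LedgerDataSync LedgerAtSync)
open YMDAG.UVSplit (SpineCarriers SpineRecordPred InputsPred U3Carriers RateCarriers RateRecordPred N14At N18At N22At ReadOutAt)
open Summit.QuantumFields.YangMills.BalabanUVNodes.N16HolderDefs (CovRootHolder N16HolderAt)
open Summit.QuantumFields.YangMills.BalabanUVNodes.SpineRatesHolder (RatesHolderAt)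
open Literature.MathematicalPhysics.QuantumFieldTheory.Balaban1983to89.T4Continuum (T4Family ULoop)
open T4WeightBudget (RelWeightBound)
open T4IndicatorShell (ShellWeightBound)
open T4ContinuumYM4Torus (ForSmallCouplings)
open T4ApexHybrid (HybridNE7Under)
open YMDAG.UVSplit (Datum RateReading₁₃CoPH rateCarriersOfRecord₁₃CoPH)
open YMDAG.UVSplit (SpineReading₁₃CoPH ShellSplit₁₃CoPH crOfRecord₁₃At crOfRecord₁₃ classSet₁₃ weightA₁₃ weightB₁₃ badClass₁₃ crOfRecord₁₃_eq
  keyedExtraction_crOfRecord₁₃At core_crOfRecord₁₃At relWeightBound_crOfRecord₁₃At shellWeightBound_crOfRecord₁₃At)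
open Node00 (Stage13HParams datumOfRecord₁₃CoPH SiteSeqKey ppSelLiveOfRecord wOfRecord₉ LocalBgMeasurable localBgMeasurable ZetaMeasurable)
open Summit.QuantumFields.YangMills.BalabanUVNodes.SpineCanonicalWeights (core_nonneg_of_shellWeightBound deltaCan)
open Summit.QuantumFields.YangMills.BalabanUVNodes.N19RateEdgeHolderAtRecord13CoPH (h19Holder_datumOfRecord₁₃CoPH_of_linkReading)
open Summit.QuantumFields.YangMills.Theorems.BalabanUVNodesN27SpineRecord (keyedGuarded₁₃CoPH_of_keyedFacesRatesHolder)

/-! ## §1 The link reading AT THE SPINE READING OF RECORD ⇒ N19′'s core and U4′'s summability at the reading's own rate -/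

section AtReading

variable {N : ℕ} [NeZero N] (K₀ : ℕ) (jcut : ℕ → ℕ) (sh : ShellSplit₁₃CoPH N K₀)
  (𝔯 : RateReading₁₃CoPH N) (G : ∀ {F : T4Family}, Stage13HParams F N → Prop) {β : ℝ} (hβ1 : β ≤ 1)
  (hlink : ∀ (F : T4Family) (θ : Stage13HParams F N) (hP : θ.Provisos₁₃CoPH F N), G θ → θ.Admissible F N →
    ∀ (g₀ : ℕ → ℝ) (os : List (ULoop F)) (k : ℕ),
      let S : SpineCarriers := crOfRecord₁₃At K₀ jcut sh F θ hP g₀ os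
      let R : RateCarriers N := rateCarriersOfRecord₁₃CoPH 𝔯 F θ hP g₀ os k
      let D : Datum F N := datumOfRecord₁₃CoPH F N θ hP
      letI := S.dec
      ∃ (_ : DecidableEq R.u3.C.Dom) (F' : Type) (ι' X' : Type) (_ : MeasurableSpace ι')
        (L : LedgerDataSync R.u3.C F' ι' S.ι) (Rd : Readings ι' X') (bsel : (ℕ → ℝ) → ℝ) (EB : Functional R.u3.C R.u3.C.BgB)
        (θc θ₃ : ℝ) (g : ℕ → ℕ → ℝ)
        (uA : ℕ → ι' → R.u3.C.BgA) (uB : ℕ → ι' → R.u3.C.BgB)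
        (Pf : ℕ → Params) (d₀ L₀ Koff : ℕ) (cells : (K j : ℕ) → R.u3.C.Dom → Finset (Site (Pf K) j))
        (H033 : Flow → ℕ → Prop) (I : Type) (fam : I → B14.Sect2Data) (Lb βw : ℝ) (κ₁ : ℕ) (Gv Cl : ℝ) (K₁ : ℕ)
        (Λ₀ N₀ : ℝ) (dressed : R.u3.C.Dom → Prop) (_ : DecidablePred dressed)
        -- N16-side letters: regime, selection, reading map, NE7 route-#1 side letters, offset
        (c' t ε₁ θ γ₃ l₁ : ℝ)
        (sel : ℕ → (B7Prop1Explicit.Site 4 → Fin 4 → (Matrix (Fin N) (Fin N) ℂ)ˣ) → (B7Prop1Explicit.Site 4 → Fin 4 → (Matrix (Fin N) (Fin N) ℂ)ˣ))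
        (rd : ι' → (B7Prop1Explicit.Site 4 → Fin 4 → (Matrix (Fin N) (Fin N) ℂ)ˣ)) (k₀ : ℕ)
        -- N17-side letters: infrared pin, β-window
        (gIR bβ : ℝ) (k₀β : ℕ)
        -- TUBE letters of the bracket (T): the (1.18) constant, the layer factor and (2.28)'s `C₁, q₁`, the flow's `β′`
        (E₀T κ₁T C₁T β'T : ℝ) (q₁ : ℕ),
        -- the run-B functional is the first-coupling family read through the selector
        EB = (fun s => R.u3.EB (bsel s) s) ∧
        -- (i) the ledger predicate for whatever size data and census constants meet their clauses
        (∀ (Sz : ℕ → ℝ → S.ι → ℕ → ℝ) (E₀ : ℝ) (m : ℕ) (a : ℝ) (Cw Λg : ℝ),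
          (∀ K t, |t| ≤ S.l₀ → ∀ τ ∈ S.T K \ S.Bad K t, ∀ v ∈ Rd.dom, ∀ j ≤ K,
            |∑ X ∈ L.fac K t τ with R.u3.C.scale X = j,
                (Real.log (Real.exp (EB (fun i => g (K + 1) (i + 1)) (uB K v) X
                    - EB (fun i => g (K + 1) (i + 1)) L.oneB X))
                  - Real.log (Real.exp (R.u3.EA (g K) (uA K v) X - R.u3.EA (g K) L.oneA X)))| ≤ Sz K t τ j) →
          0 ≤ E₀ → 0 < a → a < 1 →
          (∀ K t, |t| ≤ S.l₀ → ∀ τ ∈ S.T K \ S.Bad K t, ∀ j ≤ K,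
            Sz K t τ j ≤ S.vol * (E₀ * ((K : ℝ) + 1) ^ m * a ^ (K - j))) →
          (∀ K, Multiplicity (L.All K) R.u3.C.scale (fun X => Real.exp (-(R.u3.κ * R.u3.C.d X))) Cw S.vol Λg K) →
          (∀ K t, |t| ≤ S.l₀ → ∀ τ ∈ S.T K \ S.Bad K t,
            WindowMultiplicity (L.facO K t τ) L.scO L.wO Cw S.vol Λg (jlogOf L.Cl K) K) →
          1 ≤ Λg → L.θ' ≤ Λg →
          LedgerAtSync { L with S := Sz, E₀ := E₀, m := m, a := a, Cw := Cw, Λg := Λg } S.l₀ S.vol S.T S.Bad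
            (fun K t τ => S.A K t τ - S.shA K t τ) (fun K t τ => S.B K t τ - S.shB K t τ) Rd R.u3.EA EB R.u3.κ g uA uB
            R.u3.ω θc R.u3.θ θ₃) ∧
        0 ≤ S.vol ∧
        (∀ K t, |t| ≤ S.l₀ → ∀ τ ∈ S.T K \ S.Bad K t,
          WindowMultiplicity (L.facO K t τ) L.scO L.wO L.Cw S.vol L.Λg (jlogOf L.Cl K) K) ∧
        0 ≤ L.Cw ∧ 1 ≤ L.Λg ∧ L.θ' ≤ L.Λg ∧
        -- (ii-m) the reference ledger's lattice identification
        (∀ K, (Pf K).d = d₀) ∧ (∀ K, (Pf K).L = L₀) ∧ (∀ K, (Pf K).K = Koff + K) ∧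
        (∀ K, (Fintype.card (Site (Pf K) (Pf K).K) : ℝ) = S.vol) ∧
        kappa₀ (4 * 2 ^ d₀) (2 * d₀) ≤ R.u3.κ ∧
        (∀ K, ∀ X ∈ L.All K,
          (cells K (R.u3.C.scale X + Koff) X).Nonempty ∧ TFaceConnected (cells K (R.u3.C.scale X + Koff) X)) ∧
        (∀ K j, Set.InjOn (cells K j) ↑((L.All K).filter fun X => R.u3.C.scale X + Koff = j)) ∧
        (∀ K, ∀ X ∈ L.All K, torusTreeLen (cells K (R.u3.C.scale X + Koff) X) ≤ R.u3.C.d X) ∧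
        -- (iii) [III] Theorem 2 (2.43) AS PRINTED with window letters
        B14.Thm2Printed H033 fam Lb βw κ₁ ∧ βw < 1 ∧ 0 < βw ∧ 1 < Lb ∧ 1 ≤ Gv ∧ 0 ≤ Cl ∧
        -- (iv) the positional-count half of N14's pinned pair at a rate `≤ R.ne1.Λ`
        (∀ p K, (R.ne1.𝒯.B p K).PositionalCount fun j k => N₀ * Λ₀ ^ (k - j)) ∧ 0 ≤ N₀ ∧ 0 ≤ Λ₀ ∧ Λ₀ ≤ R.ne1.Λ ∧
        -- (ii-v-A) run A's vacuum slices ↔ printed E-terms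
        (∀ K t, |t| ≤ S.l₀ → ∀ τ ∈ S.T K \ S.Bad K t, ∀ v ∈ Rd.dom, ∀ j ≤ K, ∃ (i : I) (w : (fam i).Ω) (j' : ℕ),
          (fam i).flow.SatisfiesRG (fam i).K ∧ H033 (fam i).flow (fam i).K ∧ 1 ≤ j' ∧ j' ≤ (fam i).K ∧
          (fam i).K - j' = K - j ∧ (fam i).K ≤ K + K₁ ∧
          (∀ n, 0 ≤ (fam i).gammaVol n w) ∧ (fam i).gammaVol (fam i).K w ≤ S.vol ∧
          (∀ n, n < (fam i).K → n < jlogOf Cl (fam i).K → (fam i).gammaVol n w = 0) ∧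
          (∀ n, n < (fam i).K → jlogOf Cl (fam i).K ≤ n → (fam i).gammaVol n w ≤ S.vol * Gv ^ ((fam i).K - n)) ∧
          |∑ X ∈ (L.fac K t τ).filter (fun X => ¬ dressed X) with R.u3.C.scale X = j,
              (R.u3.EA (g K) (uA K v) X - R.u3.EA (g K) L.oneA X)| ≤ |(fam i).eTerm j' (fam i).K w|) ∧
        -- (ii-v-B) run B's vacuum slices ↔ printed E-terms
        (∀ K t, |t| ≤ S.l₀ → ∀ τ ∈ S.T K \ S.Bad K t, ∀ v ∈ Rd.dom, ∀ j ≤ K, ∃ (i : I) (w : (fam i).Ω) (j' : ℕ),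
          (fam i).flow.SatisfiesRG (fam i).K ∧ H033 (fam i).flow (fam i).K ∧ 1 ≤ j' ∧ j' ≤ (fam i).K ∧
          (fam i).K - j' = K - j ∧ (fam i).K ≤ K + K₁ ∧
          (∀ n, 0 ≤ (fam i).gammaVol n w) ∧ (fam i).gammaVol (fam i).K w ≤ S.vol ∧
          (∀ n, n < (fam i).K → n < jlogOf Cl (fam i).K → (fam i).gammaVol n w = 0) ∧
          (∀ n, n < (fam i).K → jlogOf Cl (fam i).K ≤ n → (fam i).gammaVol n w ≤ S.vol * Gv ^ ((fam i).K - n)) ∧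
          |∑ X ∈ (L.fac K t τ).filter (fun X => ¬ dressed X) with R.u3.C.scale X = j,
              (EB (fun i => g (K + 1) (i + 1)) (uB K v) X - EB (fun i => g (K + 1) (i + 1)) L.oneB X)|
            ≤ |(fam i).eTerm j' (fam i).K w|) ∧
        -- (ii-d) the dressed sub-ledger ↔ N14's bookings on `R.ne1.𝒯`
        (∀ K t, |t| ≤ S.l₀ → ∀ τ ∈ S.T K \ S.Bad K t, ∀ v ∈ Rd.dom,
          ∃ (pA : R.ne1.P) (βA : R.u3.C.Dom → (R.ne1.𝒯.B pA K).Birth) (Q : Finset (R.ne1.𝒯.B pA K).Cube) (pB : R.ne1.P)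
            (KB : ℕ) (βB : R.u3.C.Dom → (R.ne1.𝒯.B pB KB).Birth),
          (∀ X ∈ (L.fac K t τ).filter (fun X => dressed X), (R.ne1.𝒯.B pA K).birthScale (βA X) = R.u3.C.scale X) ∧
          (∀ j, Set.InjOn βA ↑(((L.fac K t τ).filter (fun X => dressed X)).filter fun X => R.u3.C.scale X = j)) ∧
          (∀ c ∈ Q, (R.ne1.𝒯.B pA K).cubeScale c = K) ∧ ((Q.card : ℝ) ≤ S.vol) ∧
          (∀ X ∈ (L.fac K t τ).filter (fun X => dressed X), ∃ c ∈ Q, βA X ∈ (R.ne1.𝒯.B pA K).feltAt c) ∧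
          (∀ X ∈ (L.fac K t τ).filter (fun X => dressed X), KB - (R.ne1.𝒯.B pB KB).birthScale (βB X) = K - R.u3.C.scale X) ∧
          (∀ X ∈ (L.fac K t τ).filter (fun X => dressed X),
            |R.u3.EA (g K) (uA K v) X - R.u3.EA (g K) L.oneA X| ≤ (R.ne1.𝒯.B pA K).size (βA X) K) ∧
          (∀ X ∈ (L.fac K t τ).filter (fun X => dressed X),
            |EB (fun i => g (K + 1) (i + 1)) (uB K v) X - EB (fun i => g (K + 1) (i + 1)) L.oneB X|
              ≤ (R.ne1.𝒯.B pB KB).size (βB X) KB)) ∧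
        -- (v′-16) N16 BY NAME: THE END's regime letters of `R.ne3`, N07's interface, the selection, NE7 route-#1's side letters, the
        -- reading map, the action-reading identification, the offset, the gauge-domination convention
        R.ne3.g = gradConst 4 c' ∧ 2 ≤ R.ne3.L ∧ 1 ≤ R.ne3.Nper ∧ 0 ≤ R.ne3.b ∧ 0 ≤ c' ∧ R.ne3.b ≤ t ∧ c' ≤ t ∧ 0 ≤ R.ne3.C ∧
        (2 : ℝ) ^ 91 * (R.ne3.L : ℝ) ^ 17 * t ≤ 1 ∧ (2 : ℝ) ^ 76 * (R.ne3.L : ℝ) ^ 12 * t ≤ R.ne3.ε ∧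
        16 * B7Prop2Explicit.C0 4 * R.ne3.ε ≤ 3 ∧ 1024 * (4 + 1) * (4 + 4) * (R.ne3.L : ℝ) ^ 2 * R.ne3.ε ≤ 1 ∧
        ε₁ ≤ 1 / 4 ∧ ε₁ ≤ R.ne3.b ∧ 4 * ε₁ ≤ c' ∧ R.ne3.dom ⊆ sfClass 4 R.ne3.L R.ne3.Nper ε₁ 0 ∧
        LeafH3sup 4 R.ne3.L R.ne3.Nper R.ne3.ε R.ne3.b c' R.ne3.dom ∧
        (∀ V ∈ R.ne3.dom, ∀ k : ℕ, IsMinimiser 4 (sfClass 4 R.ne3.L R.ne3.Nper R.ne3.ε) R.ne3.L R.ne3.Nper k V (sel k V)) ∧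
        (∀ V ∈ R.ne3.dom, ∀ k : ℕ, RegularSup 4 R.ne3.L R.ne3.Nper R.ne3.b c' k (sel k V)) ∧
        0 < θ ∧ θ ^ 6 = ((R.ne3.L : ℝ))⁻¹ ∧ 0 < R.ne3.Λ₂' ∧ 0 < γ₃ ∧
        R.ne3.C * (wallConst 4 R.ne3.L * (R.ne3.Nper : ℝ) ^ 2 *
          (Real.sqrt (gradConst 4 c') * dualC2 4 R.ne3.L + 2 * R.ne3.b ^ 2 * dualC1 4 R.ne3.L)) ≤ γ₃ ^ 3 ∧
        0 < l₁ ∧ R.ne3.Λ₁ ≤ l₁ ^ 3 ∧ γ₃ * θ ^ 2 ≤ l₁ * R.ne3.Nper ∧ θ ^ ((3 : ℝ) * β - 2) ≤ θ₃ ∧ θ₃ < 1 ∧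
        (∀ v ∈ Rd.dom, rd v ∈ R.ne3.dom) ∧
        (∀ k, ∀ v ∈ Rd.dom, Rd.act k v = minAct 4 (sfClass 4 R.ne3.L R.ne3.Nper R.ne3.ε) R.ne3.L R.ne3.Nper k (rd v)) ∧
        (R.ne3.Nper : ℝ) ^ 4 ≤ Rd.vol ∧ 1 ≤ k₀ ∧
        (∀ K : ℕ, ∀ v ∈ Rd.dom, ∀ (u : B7Prop1Explicit.Site 4 → (Matrix (Fin N) (Fin N) ℂ)ˣ)
          (Z : B7Prop1Explicit.Site 4 → Fin 4 → Matrix (Fin N) (Fin N) ℂ) (M : ℝ),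
          IsUnitarySite u → IsPeriodicSite u ((R.ne3.Nper * R.ne3.L ^ (k₀ + K) : ℕ) : ℤ) → T4AveragingDeficitWall.IsSkewDir Z →
          IsPeriodicDir Z ((R.ne3.Nper * R.ne3.L ^ (k₀ + K) : ℕ) : ℤ) →
          B7Prop1Explicit.gaugeAct u (sel (k₀ + K) (rd v)) =
            T4AveragingDeficitWall.vary (B7Prop2Explicit.rescale R.ne3.L (B7Prop1Explicit.bavg R.ne3.L (sel (k₀ + K + 1) (rd v)))) Z 1 →
          (∀ (x : B7Prop1Explicit.Site 4) (κ : Fin 4), (R.ne3.L : ℝ) ^ (k₀ + K) * ‖Z x κ‖ ≤ M) →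
          (∀ (x : B7Prop1Explicit.Site 4) (μ κ : Fin 4), ((R.ne3.L : ℝ) ^ (k₀ + K)) ^ 2 *
              ‖T4AveragingDeficitWall.Ad (B7Prop2Explicit.rescale R.ne3.L (B7Prop1Explicit.bavg R.ne3.L (sel (k₀ + K + 1) (rd v)))
                  (x + B7Prop1Explicit.e κ) μ) (Z (x + B7Prop1Explicit.e μ) κ) - Z x κ‖ ≤ M) →
          R.u3.C.gauge (uA K v) (R.u3.C.transport (uB K v)) ≤ M) ∧
        -- letter signs
        0 ≤ R.u3.θ ∧ 0 ≤ R.u3.C₅ ∧ 0 ≤ R.u3.ω ∧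
        -- (v′-17) N17 BY NAME: the (0.20)-run identification, the infrared pin, (D4), the β-window, the smallness window, rates
        (∀ K, RGEqH K D.βfun (g K)) ∧ (∀ K, g K K = gIR) ∧ ReadOutAt D R.u3 ∧ 0 < bβ ∧
        EventualLowerH bβ R.u3.γ k₀β D.βfun ∧
        R.u3.cr * R.u3.C₉ * R.u3.ω * (((k₀β : ℝ) + 1) * R.u3.γ ^ 3 + 2 * R.u3.γ / bβ) ≤ (1 - R.u3.ρ) / 2 ∧
        0 < R.u3.ρ ∧ R.u3.ρ < 1 ∧ 0 < R.u3.γ ∧ R.u3.ρ ≤ θc ∧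
        -- the box
        (∀ K i, i ≤ K → 0 < g K i ∧ g K i ≤ R.u3.γ) ∧
        -- the bracket (T) IN THE TUBE CURRENCY (`N19LipBracketTube.lipBracket_at_rateCarriers_of_pairDisc`'s inputs): the (1.18) real
        -- bound; the pair-disc shape at the printed tube radius κ₁·α(C₁, q₁, s_j) ((2.27)(ii)(iv) through the (1.13)∕(2.39) tube — SHAPE,
        -- NODE O); signs; the window's smallness; the UPPER running of the tables ((2.6) ∕ (0.31) upper half, β-side conditional, DISPLAYED)
        DecayBound R.u3.EA R.u3.W E₀T R.u3.κ ∧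
        (∀ s ∈ R.u3.W, ∀ (X : R.u3.C.Dom) (U U' : R.u3.C.BgA),
          R.u3.C.gauge U U' < κ₁T * B14.alphaJ C₁T q₁ (s (R.u3.C.scale X)) →
          ∃ f : ℂ → ℂ, DifferentiableOn ℂ f (Metric.ball (0 : ℂ) (κ₁T * B14.alphaJ C₁T q₁ (s (R.u3.C.scale X)))) ∧
            f 0 = (R.u3.EA s U X : ℂ) ∧ f (R.u3.C.gauge U U' : ℂ) = (R.u3.EA s U' X : ℂ) ∧
            ∀ z ∈ Metric.ball (0 : ℂ) (κ₁T * B14.alphaJ C₁T q₁ (s (R.u3.C.scale X))),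
              ‖f z‖ ≤ E₀T * Real.exp (-(R.u3.κ * R.u3.C.d X))) ∧
        0 ≤ E₀T ∧ 0 < κ₁T ∧ 0 < C₁T ∧ (∀ s ∈ R.u3.W, ∀ j, 0 < s j ∧ s j ^ 2 ≤ Real.exp (-1)) ∧
        (∀ K j, j ≤ K → 1 / g K j ^ 2 ≤ 1 / gIR ^ 2 + β'T * ((K : ℝ) - j)) ∧ 0 ≤ β'T ∧
        -- window memberships, selector compatibility
        (∀ K, g K ∈ R.u3.W) ∧ (∀ K, (fun i => g (K + 1) (i + 1)) ∈ R.u3.W) ∧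
        (∀ s ∈ R.u3.W, 0 < bsel s ∧ bsel s ≤ R.u3.γ))

include hβ1 hlink

/-- ★★ **N19′'s CORE AND U4′'s SUMMABILITY AT THE SPINE READING OF RECORD's OWN RATE, BY NAME, MODULO THE LINK READING** [bookkeeping]: for every
admissible Stage-13 `θ` with provisos in the guard, every `g₀`, `os`, run length `k`: IF K4's β-rates `RatesHolderAt (datumOfRecord₁₃CoPH F N θ hP)
(rateCarriersOfRecord₁₃CoPH 𝔯 F θ hP g₀ os k) β` hold and the good-class cores are non-negative (`hP0` — supplied by ANY shell witness, next lemma), THEN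
`NE7.Core S.l₀ S.vol S.T S.Bad (S.A − S.shA) (S.B − S.shB) S.δ ∧ Summable S.δ` for `S := crOfRecord₁₃At K₀ jcut sh F θ hP g₀ os` — the sibling F's
`h19Holder_datumOfRecord₁₃CoPH_of_linkReading` at `cr := crOfRecord₁₃At K₀ jcut sh` (an `∃ δ`) composed with dag-n20-d's transfer `core_crOfRecord₁₃At`
(the reading's `δ = deltaCan …` is CANONICAL: least admissible core rate + `2^{−K}`).  READING RULE (ref-B PIN-N19-DELTAOFRECORD, verbatim): `Summable S.δ`
here is a COROLLARY of the edge, NOT independent content — the content sits in `hlink` (NODE O's world) and `hr` (K4).  NOT NE7; N19 NOT discharged.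
[folklore] -/
theorem core_crOfRecord₁₃At_of_linkReading
    (F : T4Family) (θ : Stage13HParams F N) (hP : θ.Provisos₁₃CoPH F N) (hG : G θ) (hθ : θ.Admissible F N) (g₀ : ℕ → ℝ) (os : List (ULoop F)) (k : ℕ)
    (hr : RatesHolderAt (datumOfRecord₁₃CoPH F N θ hP) (rateCarriersOfRecord₁₃CoPH 𝔯 F θ hP g₀ os k) β)
    (hP0 : letI : DecidableEq (Σ K, SiteSeqKey F (K₀ + K)) := Classical.decEq _
      ∀ (K : ℕ) (t : ℝ), |t| ≤ 1 → ∀ x ∈ classSet₁₃ θ K₀ g₀ K \ badClass₁₃ θ K₀ g₀ jcut K t,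
        0 ≤ weightA₁₃ θ hP K₀ g₀ os K t x - (sh F θ hP g₀ os).1 K t x) :
    (letI := (crOfRecord₁₃At K₀ jcut sh F θ hP g₀ os).dec
     NE7.Core (crOfRecord₁₃At K₀ jcut sh F θ hP g₀ os).l₀ (crOfRecord₁₃At K₀ jcut sh F θ hP g₀ os).vol (crOfRecord₁₃At K₀ jcut sh F θ hP g₀ os).T
       (crOfRecord₁₃At K₀ jcut sh F θ hP g₀ os).Bad
       (fun K t τ => (crOfRecord₁₃At K₀ jcut sh F θ hP g₀ os).A K t τ - (crOfRecord₁₃At K₀ jcut sh F θ hP g₀ os).shA K t τ)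
       (fun K t τ => (crOfRecord₁₃At K₀ jcut sh F θ hP g₀ os).B K t τ - (crOfRecord₁₃At K₀ jcut sh F θ hP g₀ os).shB K t τ)
       (crOfRecord₁₃At K₀ jcut sh F θ hP g₀ os).δ) ∧
      Summable (crOfRecord₁₃At K₀ jcut sh F θ hP g₀ os).δ := by
  obtain ⟨δ, hcore, hsum⟩ :=
    h19Holder_datumOfRecord₁₃CoPH_of_linkReading (crOfRecord₁₃At K₀ jcut sh) 𝔯 G hβ1 hlink F θ hP hG hθ g₀ os k hr
  exact core_crOfRecord₁₃At K₀ jcut sh θ hP g₀ os hP0 hcore hsum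

/-- ★ **THE SAME WITH THE SIGN CONDITION READ FROM ANY SHELL WITNESS** at the reading's keyed carriers (`ShellWeightBound 1 (classSet₁₃ …) (weightA₁₃ …)
(weightB₁₃ …) (sh …).1 (sh …).2 Wsh` for SOME `Wsh` — N21's face in any currency; dag-n20-d FILE A `core_nonneg_of_shellWeightBound`). [folklore] -/
theorem core_crOfRecord₁₃At_of_linkReading_of_shellWeightBound
    (F : T4Family) (θ : Stage13HParams F N) (hP : θ.Provisos₁₃CoPH F N) (hG : G θ) (hθ : θ.Admissible F N) (g₀ : ℕ → ℝ) (os : List (ULoop F)) (k : ℕ)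
    (hr : RatesHolderAt (datumOfRecord₁₃CoPH F N θ hP) (rateCarriersOfRecord₁₃CoPH 𝔯 F θ hP g₀ os k) β) {Wsh : ℕ → ℝ}
    (hsh : ShellWeightBound 1 (classSet₁₃ θ K₀ g₀) (weightA₁₃ θ hP K₀ g₀ os) (weightB₁₃ θ hP K₀ g₀ os) (sh F θ hP g₀ os).1 (sh F θ hP g₀ os).2 Wsh) :
    (letI := (crOfRecord₁₃At K₀ jcut sh F θ hP g₀ os).dec
     NE7.Core (crOfRecord₁₃At K₀ jcut sh F θ hP g₀ os).l₀ (crOfRecord₁₃At K₀ jcut sh F θ hP g₀ os).vol (crOfRecord₁₃At K₀ jcut sh F θ hP g₀ os).T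
       (crOfRecord₁₃At K₀ jcut sh F θ hP g₀ os).Bad
       (fun K t τ => (crOfRecord₁₃At K₀ jcut sh F θ hP g₀ os).A K t τ - (crOfRecord₁₃At K₀ jcut sh F θ hP g₀ os).shA K t τ)
       (fun K t τ => (crOfRecord₁₃At K₀ jcut sh F θ hP g₀ os).B K t τ - (crOfRecord₁₃At K₀ jcut sh F θ hP g₀ os).shB K t τ)
       (crOfRecord₁₃At K₀ jcut sh F θ hP g₀ os).δ) ∧
      Summable (crOfRecord₁₃At K₀ jcut sh F θ hP g₀ os).δ :=
  core_crOfRecord₁₃At_of_linkReading K₀ jcut sh 𝔯 G hβ1 hlink F θ hP hG hθ g₀ os k hr (by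
    letI : DecidableEq (Σ K, SiteSeqKey F (K₀ + K)) := Classical.decEq _
    exact core_nonneg_of_shellWeightBound hsh)

/-- ★ **THE SAME WITH N21's FACE AS LEAF D DISPLAYS IT** (`ShellWeightBound S.l₀ S.T S.A S.B S.shA S.shB S.Wsh` at the reading `S` itself — its `Wsh` the
canonical one). [folklore] -/
theorem core_crOfRecord₁₃At_of_linkReading_of_shellWeightBound_self
    (F : T4Family) (θ : Stage13HParams F N) (hP : θ.Provisos₁₃CoPH F N) (hG : G θ) (hθ : θ.Admissible F N) (g₀ : ℕ → ℝ) (os : List (ULoop F)) (k : ℕ)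
    (hr : RatesHolderAt (datumOfRecord₁₃CoPH F N θ hP) (rateCarriersOfRecord₁₃CoPH 𝔯 F θ hP g₀ os k) β)
    (hsh : ShellWeightBound (crOfRecord₁₃At K₀ jcut sh F θ hP g₀ os).l₀ (crOfRecord₁₃At K₀ jcut sh F θ hP g₀ os).T (crOfRecord₁₃At K₀ jcut sh F θ hP g₀ os).A
      (crOfRecord₁₃At K₀ jcut sh F θ hP g₀ os).B (crOfRecord₁₃At K₀ jcut sh F θ hP g₀ os).shA (crOfRecord₁₃At K₀ jcut sh F θ hP g₀ os).shB
      (crOfRecord₁₃At K₀ jcut sh F θ hP g₀ os).Wsh) :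
    (letI := (crOfRecord₁₃At K₀ jcut sh F θ hP g₀ os).dec
     NE7.Core (crOfRecord₁₃At K₀ jcut sh F θ hP g₀ os).l₀ (crOfRecord₁₃At K₀ jcut sh F θ hP g₀ os).vol (crOfRecord₁₃At K₀ jcut sh F θ hP g₀ os).T
       (crOfRecord₁₃At K₀ jcut sh F θ hP g₀ os).Bad
       (fun K t τ => (crOfRecord₁₃At K₀ jcut sh F θ hP g₀ os).A K t τ - (crOfRecord₁₃At K₀ jcut sh F θ hP g₀ os).shA K t τ)
       (fun K t τ => (crOfRecord₁₃At K₀ jcut sh F θ hP g₀ os).B K t τ - (crOfRecord₁₃At K₀ jcut sh F θ hP g₀ os).shB K t τ)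
       (crOfRecord₁₃At K₀ jcut sh F θ hP g₀ os).δ) ∧
      Summable (crOfRecord₁₃At K₀ jcut sh F θ hP g₀ os).δ :=
  core_crOfRecord₁₃At_of_linkReading_of_shellWeightBound K₀ jcut sh 𝔯 G hβ1 hlink F θ hP hG hθ g₀ os k hr
    (Wsh := (crOfRecord₁₃At K₀ jcut sh F θ hP g₀ os).Wsh) hsh

/-! ## §2 dag-n27-c's guarded θ-keyed B5 (XXIVc) AT THE READING: N19's binder from the link reading, N27's extraction clause a THEOREM -/

/-- ★ **`HybridNE7Under` AT EVERY GUARDED ADMISSIBLE STAGE-13 TUPLE, AT THE SPINE READING OF RECORD** [bookkeeping]: XXIVc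
`keyedGuarded₁₃CoPH_of_keyedFacesRatesHolder` at `cr := crOfRecord₁₃At K₀ jcut sh` for the rate reading `rr F θ hP g₀ os := rateCarriersOfRecord₁₃CoPH 𝔯 F θ hP
g₀ os (ks F θ hP g₀ os)`, with: `h19 :=` §1; `hx :=` dag-n20-d's THEOREM `keyedExtraction_crOfRecord₁₃At` under the DISPLAYED live-selector pin laws
`hsel` ∕ `hζm` ∕ `hζ0` (the local-background measurability is node00-def-K0c's absolute `localBgMeasurable`); `h20` ∕ `h21` from ANY witnesses at the
reading's keyed carriers (dag-n20-d's transfers `relWeightBound_crOfRecord₁₃At` ∕ `shellWeightBound_crOfRecord₁₃At`); `hrates` displayed.  NOT a discharge.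
[folklore] -/
theorem hybridNE7Under_guarded_datumOfRecord₁₃CoPH_crOfRecord₁₃At_of_ratesHolder_linkReading
    (ks : (F : T4Family) → (θ : Stage13HParams F N) → θ.Provisos₁₃CoPH F N → (ℕ → ℝ) → List (ULoop F) → ℕ)
    (E : (F : T4Family) → (θ : Stage13HParams F N) → θ.Provisos₁₃CoPH F N → B12.RunParams → ℝ)
    (hsel : ∀ (F : T4Family) (θ : Stage13HParams F N) (hP : θ.Provisos₁₃CoPH F N), G θ → θ.Admissible F N →
      θ.ppSel = ppSelLiveOfRecord F N θ.ν θ.τ9 (E F θ hP) (wOfRecord₉ F N θ.toStage9Params))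
    (hζm : ∀ (F : T4Family) (θ : Stage13HParams F N) (hP : θ.Provisos₁₃CoPH F N), G θ → θ.Admissible F N → ZetaMeasurable F N θ.ζ)
    (hζ0 : ∀ (F : T4Family) (θ : Stage13HParams F N) (hP : θ.Provisos₁₃CoPH F N), G θ → θ.Admissible F N →
      ∀ p g k s Pl Ql RS U V', 0 ≤ θ.ζ p g k s Pl Ql RS U V')
    (h20 : ∀ (F : T4Family) (θ : Stage13HParams F N) (hP : θ.Provisos₁₃CoPH F N), G θ → θ.Admissible F N → ∀ (g₀ : ℕ → ℝ) (os : List (ULoop F)),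
      ∃ W : ℕ → ℝ, RelWeightBound 1 (classSet₁₃ θ K₀ g₀) (weightA₁₃ θ hP K₀ g₀ os) (weightB₁₃ θ hP K₀ g₀ os) (badClass₁₃ θ K₀ g₀ jcut) W)
    (h21 : ∀ (F : T4Family) (θ : Stage13HParams F N) (hP : θ.Provisos₁₃CoPH F N), G θ → θ.Admissible F N → ∀ (g₀ : ℕ → ℝ) (os : List (ULoop F)),
      ∃ Wsh : ℕ → ℝ, ShellWeightBound 1 (classSet₁₃ θ K₀ g₀) (weightA₁₃ θ hP K₀ g₀ os) (weightB₁₃ θ hP K₀ g₀ os) (sh F θ hP g₀ os).1 (sh F θ hP g₀ os).2 Wsh)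
    (hrates : ∀ (F : T4Family) (θ : Stage13HParams F N) (hP : θ.Provisos₁₃CoPH F N), G θ → θ.Admissible F N → ∀ (g₀ : ℕ → ℝ) (os : List (ULoop F)),
      RatesHolderAt (datumOfRecord₁₃CoPH F N θ hP) (rateCarriersOfRecord₁₃CoPH 𝔯 F θ hP g₀ os (ks F θ hP g₀ os)) β)
    (F : T4Family) (θ : Stage13HParams F N) (hP : θ.Provisos₁₃CoPH F N) (hG : G θ) (hθ : θ.Admissible F N) :
    HybridNE7Under (datumOfRecord₁₃CoPH F N θ hP) (DagBinding.EndpointExistence (datumOfRecord₁₃CoPH F N θ hP).C.toB12) :=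
  keyedGuarded₁₃CoPH_of_keyedFacesRatesHolder (crOfRecord₁₃At K₀ jcut sh)
    (fun F θ hP g₀ os => rateCarriersOfRecord₁₃CoPH 𝔯 F θ hP g₀ os (ks F θ hP g₀ os)) G β
    (fun F θ hP hG hθ g₀ os => (h20 F θ hP hG hθ g₀ os).elim fun _ hW => relWeightBound_crOfRecord₁₃At K₀ jcut sh θ hP g₀ os hW)
    (fun F θ hP hG hθ g₀ os => (h21 F θ hP hG hθ g₀ os).elim fun _ hW => shellWeightBound_crOfRecord₁₃At K₀ jcut sh θ hP g₀ os hW)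
    hrates
    (fun F θ hP hG hθ g₀ os hr =>
      h19Holder_datumOfRecord₁₃CoPH_of_linkReading (crOfRecord₁₃At K₀ jcut sh) 𝔯 G hβ1 hlink F θ hP hG hθ g₀ os (ks F θ hP g₀ os) hr)
    (fun F θ hP hG hθ _ _ =>
      keyedExtraction_crOfRecord₁₃At K₀ jcut sh θ hP (E F θ hP) (hsel F θ hP hG hθ) (localBgMeasurable F N θ.ν) (hζm F θ hP hG hθ) (hζ0 F θ hP hG hθ))
    F θ hP hG hθ

end AtReading

end Summit.QuantumFields.YangMills.BalabanUVNodes.N19RateEdgeHolderAtSpineReadingOfRecord13CoPH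

end
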